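import Summits.PneNP.PneNP.Theorems.ConstantBand.Negative.LoadBearing
import Summits.PneNP.PneNP.Theorems.SliceACZero.Negative.WindowDepth
import Literature.Computability.Complexity.CliqueThresholdBounds

/-!
# Crux `SliceTarget` (stmt-PneNP-2832), line `Sketch-ideator3-r1`: stub T5 `CoincidenceTail2`

On a central slice of the critical random graph (uniform edge vectors `x` with `edgeCount x = j`,
`|j - m_k(n)| ≤ m_k(n)^{3/4}`, `m_k(n) = thr k n = ⌊C(n,2)·n^{-2/(k-1)}⌋₊`) the graphs with at least two `k`-cliques
have density at most `(1/k!)²/2 + ε` eventually, uniformly over the window (`stub_coincidenceTail2`): the elementary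
second factorial moment bound `2·P_j[ω_k ≥ 2] ≤ E_j[ω_k(ω_k - 1)]` (Rossman, FOCS 2010, App. B, proof of Lemma 23 (a),
moved from `G(n,p)` onto the slice). With `q = j/C(n,2)`, `μ = C(n,k) q^{C(k,2)}`:
* double counting `2·#{x ∈ slice_j : ω_k(x) ≥ 2} ≤ Σ_{A ≠ B} #{x ∈ slice_j : K_A ∪ K_B ⊆ x}` (`two_mul_card_filter_two_le`);
* hypergeometric tail `#{x ∈ slice_j : F ⊆ x} ≤ q^{|F|}·#slice_j` and `|E(K_A ∪ K_B)| = 2·C(k,2) - C(|A ∩ B|,2)`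
  (`card_slice_filter_supset_mul_le`, `card_cliqueEdges_union_add`, `card_slice_twoCliques_le`);
* the overlap sum split by `i = |A ∩ B|`: `Σ_{B ≠ A} q^{C(k,2)-C(i,2)} ≤ C(n,k) q^{C(k,2)} + Σ_{i=2}^{k-1} C(k,i) C(n,k-i)
  q^{C(k,2)-C(i,2)} =: μ + R(q)` (`sum_ite_pow_le`), whence `2·P_j[ω_k ≥ 2] ≤ μ (μ + R(q))` (`two_mul_card_le_moment`);
* the window: for central `j`, `q ≤ n^{-2/(k-1)} (1 + T^{-1/4})` with `T = C(n,2) n^{-2/(k-1)} → ∞`, so `μ ≤ (1 + o(1))/k!`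
  (`choose_mul_ratio_pow_le'`) and `R(q) = O(Σ_i n^{-i(k-i)/(k-1)}) → 0`.
-/

set_option linter.dupNamespace false

namespace Summit.PneNP.PneNP.Cruxes.SliceTarget.Ideator3Line

open Literature.Computability.Complexity Finset Filter Classical
open scoped Topology
open Summit.PneNP.PneNP.Theorems.ConstantBand.Negative (Edge thr Central slice)
open Summit.PneNP.PneNP.Theorems.SliceACZero.Negative (sliceCard_eq card_slice_supset_le
  choose_sub_mul_pow_le_choose_mul_pow choose_mul_ratio_pow_le')

noncomputable section

/-- **Hypergeometric tail on a slice**, product form: for `j ≤ C(n,2)` and a fixed edge set `F`,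
`#{x ∈ slice_j : F ⊆ x} · C(n,2)^{|F|} ≤ j^{|F|} · #slice_j`. [folklore] -/
private theorem card_slice_filter_supset_mul_le {n : ℕ} (F : Finset (Edge n)) {j : ℕ} (hj : j ≤ n.choose 2) :
    #((slice n j).filter fun x => ∀ e ∈ F, x e = true) * (n.choose 2) ^ #F ≤ j ^ #F * #(slice n j) := by
  -- adapted from Theorems/OneSliceConstantBandTransferStepAux.lean (`ts_card_slice_filter_supset_mul_le`)
  have hslice : #(slice n j) = (n.choose 2).choose j := sliceCard_eq n j
  by_cases hF : #F ≤ j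
  · have h1 : #((slice n j).filter fun x => ∀ e ∈ F, x e = true) ≤ (n.choose 2 - #F).choose (j - #F) := by
      have h := card_slice_supset_le j F hF
      rwa [← filter_filter] at h
    calc #((slice n j).filter fun x => ∀ e ∈ F, x e = true) * (n.choose 2) ^ #F
        ≤ (n.choose 2 - #F).choose (j - #F) * (n.choose 2) ^ #F := Nat.mul_le_mul_right _ h1
      _ ≤ (n.choose 2).choose j * j ^ #F := choose_sub_mul_pow_le_choose_mul_pow hF hj
      _ = j ^ #F * #(slice n j) := by rw [hslice, mul_comm]
  · have h0 : (slice n j).filter (fun x => ∀ e ∈ F, x e = true) = ∅ := by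
      refine filter_eq_empty_iff.2 fun x hx hall => hF ?_
      rw [← (mem_filter.1 hx).2, edgeCount]
      exact card_le_card fun e he => mem_filter.2 ⟨mem_univ _, hall e he⟩
    simp only [h0, card_empty, zero_mul, Nat.zero_le]

/-- The edge sets of two cliques: `|E(K_A) ∪ E(K_B)| + C(|A ∩ B|,2) = C(|A|,2) + C(|B|,2)`
(`E(K_A) ∩ E(K_B) = E(K_{A ∩ B})`). [folklore] -/
private theorem card_cliqueEdges_union_add {n : ℕ} (A B : Finset (Fin n)) :
    #(univ.filter fun e : Edge n => cliqueVec A e = true ∨ cliqueVec B e = true) + (#(A ∩ B)).choose 2 =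
      (#A).choose 2 + (#B).choose 2 := by
  have hinter : (univ.filter fun e : Edge n => cliqueVec A e = true) ∩ (univ.filter fun e : Edge n => cliqueVec B e = true) =
      univ.filter fun e : Edge n => cliqueVec (A ∩ B) e = true := by
    rw [← filter_and]
    refine filter_congr fun e _ => ?_
    rw [cliqueVec_inter, Bool.and_eq_true]
    tauto
  rw [← card_filter_cliqueVec A, ← card_filter_cliqueVec B, ← card_filter_cliqueVec (A ∩ B),
    ← card_union_add_card_inter (univ.filter fun e : Edge n => cliqueVec A e = true)
      (univ.filter fun e : Edge n => cliqueVec B e = true), hinter, filter_or]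

/-- **Two cliques on a slice**: for `k`-sets `A, B` and `j ≤ C(n,2)`, with `q = j/C(n,2)`,
`#{x ∈ slice_j : K_A ⊆ x ∧ K_B ⊆ x} ≤ q^{C(k,2)} · q^{C(k,2) - C(|A ∩ B|,2)} · #slice_j`. [folklore] -/
private theorem card_slice_twoCliques_le {n k j : ℕ} (hjN : j ≤ n.choose 2) (hN : 0 < n.choose 2)
    {A B : Finset (Fin n)} (hA : #A = k) (hB : #B = k) :
    (#((slice n j).filter fun x => (∀ e, cliqueVec A e = true → x e = true) ∧ (∀ e, cliqueVec B e = true → x e = true)) : ℝ)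
      ≤ ((j : ℝ) / (n.choose 2 : ℕ)) ^ k.choose 2 * ((j : ℝ) / (n.choose 2 : ℕ)) ^ (k.choose 2 - (#(A ∩ B)).choose 2) *
        #(slice n j) := by
  set F : Finset (Edge n) := univ.filter fun e : Edge n => cliqueVec A e = true ∨ cliqueVec B e = true with hF
  have hCle : (#(A ∩ B)).choose 2 ≤ k.choose 2 := Nat.choose_le_choose 2 (hA ▸ card_le_card inter_subset_left)
  have hcardF : #F = k.choose 2 + (k.choose 2 - (#(A ∩ B)).choose 2) := by
    have h : #F + (#(A ∩ B)).choose 2 = (#A).choose 2 + (#B).choose 2 := card_cliqueEdges_union_add A B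
    rw [hA, hB] at h
    omega
  have hsub : ((slice n j).filter fun x => (∀ e, cliqueVec A e = true → x e = true) ∧
      (∀ e, cliqueVec B e = true → x e = true)) ⊆ (slice n j).filter fun x => ∀ e ∈ F, x e = true := by
    intro x hx
    rw [mem_filter] at hx ⊢
    refine ⟨hx.1, fun e he => ?_⟩
    rcases (mem_filter.1 he).2 with h | h
    · exact hx.2.1 e h
    · exact hx.2.2 e h
  have h1 := card_slice_filter_supset_mul_le F hjN
  have h2 := card_le_card hsub
  have hNr : (0 : ℝ) < (n.choose 2 : ℕ) := by exact_mod_cast hN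
  rw [← pow_add, ← hcardF, div_pow, div_mul_eq_mul_div, le_div_iff₀ (pow_pos hNr _)]
  calc (#((slice n j).filter fun x => (∀ e, cliqueVec A e = true → x e = true) ∧
          (∀ e, cliqueVec B e = true → x e = true)) : ℝ) * ((n.choose 2 : ℕ) : ℝ) ^ #F
      ≤ (#((slice n j).filter fun x => ∀ e ∈ F, x e = true) : ℝ) * ((n.choose 2 : ℕ) : ℝ) ^ #F := by gcongr
    _ ≤ (j : ℝ) ^ #F * #(slice n j) := by exact_mod_cast h1

/-- **Double counting**: a graph with `ω_k ≥ 2` contains an ordered pair of distinct `k`-cliques, so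
`2 · #{x ∈ slice_j : ω_k(x) ≥ 2} ≤ Σ_{A ≠ B} #{x ∈ slice_j : K_A ⊆ x ∧ K_B ⊆ x}`. [folklore] -/
private theorem two_mul_card_filter_two_le (n k j : ℕ) :
    2 * #((slice n j).filter fun x => 2 ≤ cliqueCount n k x) ≤
      ∑ p ∈ (powersetCard k (univ : Finset (Fin n)) ×ˢ powersetCard k (univ : Finset (Fin n))).filter (fun p => p.1 ≠ p.2),
        #((slice n j).filter fun x => (∀ e, cliqueVec p.1 e = true → x e = true) ∧ (∀ e, cliqueVec p.2 e = true → x e = true)) := by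
  set 𝒜 := powersetCard k (univ : Finset (Fin n)) with h𝒜
  -- each `x` with `ω_k(x) ≥ 2` lies in `≥ 2` of the sets (an ordered pair of distinct cliques and its swap)
  have key : ∀ x ∈ (slice n j).filter (fun x => 2 ≤ cliqueCount n k x), 2 ≤ #(((𝒜 ×ˢ 𝒜).filter (fun p => p.1 ≠ p.2)).filter
      fun p => (∀ e, cliqueVec p.1 e = true → x e = true) ∧ (∀ e, cliqueVec p.2 e = true → x e = true)) := by
    intro x hx
    have hx2 : 2 ≤ cliqueCount n k x := (mem_filter.1 hx).2
    unfold cliqueCount at hx2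
    obtain ⟨a, ha, b, hb, hab⟩ := one_lt_card.1 (lt_of_lt_of_le one_lt_two hx2)
    rw [mem_filter] at ha hb
    have hmem : ∀ c d : Finset (Fin n), c ∈ 𝒜 → d ∈ 𝒜 → c ≠ d →
        (∀ e, cliqueVec c e = true → x e = true) → (∀ e, cliqueVec d e = true → x e = true) →
        (c, d) ∈ ((𝒜 ×ˢ 𝒜).filter (fun p => p.1 ≠ p.2)).filter
          fun p => (∀ e, cliqueVec p.1 e = true → x e = true) ∧ (∀ e, cliqueVec p.2 e = true → x e = true) := by
      intro c d hc hd hcd hxc hxd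
      simp only [mem_filter, mem_product]
      exact ⟨⟨⟨hc, hd⟩, hcd⟩, hxc, hxd⟩
    have hne : (a, b) ≠ (b, a) := fun h => hab (Prod.mk.inj h).1
    rw [← card_pair hne]
    refine card_le_card fun p hp => ?_
    simp only [mem_insert, mem_singleton] at hp
    rcases hp with rfl | rfl
    · exact hmem a b ha.1 hb.1 hab ha.2 hb.2
    · exact hmem b a hb.1 ha.1 hab.symm hb.2 ha.2
  -- double counting `Σ_p #{x : …} = Σ_x #{p : …}` (Mathlib's bipartite double counting)
  have hswap := sum_card_bipartiteAbove_eq_sum_card_bipartiteBelow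
    (fun (p : Finset (Fin n) × Finset (Fin n)) (x : Edge n → Bool) =>
      (∀ e, cliqueVec p.1 e = true → x e = true) ∧ (∀ e, cliqueVec p.2 e = true → x e = true))
    (s := (𝒜 ×ˢ 𝒜).filter (fun p => p.1 ≠ p.2)) (t := slice n j)
  simp only [bipartiteAbove, bipartiteBelow] at hswap
  calc 2 * #((slice n j).filter fun x => 2 ≤ cliqueCount n k x)
      = ∑ x ∈ (slice n j).filter (fun x => 2 ≤ cliqueCount n k x), 2 := by rw [sum_const, smul_eq_mul, mul_comm]
    _ ≤ _ := sum_le_sum key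
    _ ≤ _ := sum_le_sum_of_subset_of_nonneg (filter_subset _ _) fun _ _ _ => Nat.zero_le _
    _ = _ := hswap.symm

/-- Two distinct `k`-sets meet in fewer than `k` vertices. [folklore] -/
private theorem card_inter_lt_of_ne {n k : ℕ} {A B : Finset (Fin n)} (hA : A ∈ powersetCard k (univ : Finset (Fin n)))
    (hB : B ∈ powersetCard k (univ : Finset (Fin n))) (hne : A ≠ B) : #(A ∩ B) < k := by
  -- adapted from `Rossman2010L23.card_inter_lt_of_ne` (RossmanMonotoneCliqueLemma23Proofs.lean)
  have hAk := (mem_powersetCard.1 hA).2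
  have hBk := (mem_powersetCard.1 hB).2
  by_contra hlt
  have h1 : A ∩ B = A := eq_of_subset_of_card_le inter_subset_left (by omega)
  exact hne (eq_of_subset_of_card_le (h1 ▸ inter_subset_right) (by omega))

/-- The `k`-sets meeting a fixed `k`-set `A` in exactly `i` vertices number at most `C(k,i) · C(n,k-i)`
(`B ↦ (A ∩ B, B ∖ A)` is injective). [folklore] -/
private theorem card_filter_card_inter_eq_le {n k : ℕ} {A : Finset (Fin n)} (hA : #A = k) (i : ℕ) :
    #((powersetCard k (univ : Finset (Fin n))).filter fun B => #(A ∩ B) = i) ≤ k.choose i * n.choose (k - i) := by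
  -- adapted from the fibre count in `Rossman2010L23.gnpProb_bad_le` (RossmanMonotoneCliqueLemma23Proofs.lean)
  calc #((powersetCard k (univ : Finset (Fin n))).filter fun B => #(A ∩ B) = i)
      ≤ #((powersetCard i A) ×ˢ (powersetCard (k - i) (univ : Finset (Fin n)))) := by
        refine card_le_card_of_injOn (fun B => (A ∩ B, B \ A)) (fun B hB => ?_) (fun B₁ _ B₂ _ h => ?_)
        · have hB' := hB
          simp only [mem_coe, mem_filter] at hB'
          obtain ⟨hB𝒜, hi⟩ := hB'
          have hBk : #B = k := (mem_powersetCard.1 hB𝒜).2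
          simp only [mem_coe, mem_product, mem_powersetCard]
          refine ⟨⟨inter_subset_left, hi⟩, subset_univ _, ?_⟩
          have := card_sdiff_add_card_inter B A
          rw [inter_comm] at hi
          omega
        · simp only [Prod.mk.injEq] at h
          ext v
          by_cases hv : v ∈ A
          · simpa [hv] using congrArg (v ∈ ·) h.1
          · simpa [hv] using congrArg (v ∈ ·) h.2
    _ = k.choose i * n.choose (k - i) := by
        rw [card_product, card_powersetCard, card_powersetCard, hA, card_univ, Fintype.card_fin]

/-- **The overlap sum, split by `i = |A ∩ B|`**: for a `k`-set `A` and `q ≥ 0`,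
`Σ_{B ≠ A} q^{C(k,2)} q^{C(k,2) - C(|A ∩ B|,2)} ≤ q^{C(k,2)} (C(n,k) q^{C(k,2)} + Σ_{i=2}^{k-1} C(k,i) C(n,k-i) q^{C(k,2) - C(i,2)})`
— the `B` with `|A ∩ B| ≤ 1` are edge-disjoint from `A` (`C(i,2) = 0`), the others have `2 ≤ |A ∩ B| ≤ k - 1`. [folklore] -/
private theorem sum_ite_pow_le {n k : ℕ} {A : Finset (Fin n)} (hA : A ∈ powersetCard k (univ : Finset (Fin n))) {q : ℝ}
    (hq : 0 ≤ q) :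
    ∑ B ∈ powersetCard k (univ : Finset (Fin n)), (if A ≠ B then q ^ k.choose 2 * q ^ (k.choose 2 - (#(A ∩ B)).choose 2) else 0)
      ≤ q ^ k.choose 2 * ((n.choose k : ℝ) * q ^ k.choose 2 +
        ∑ i ∈ Ico 2 k, ((k.choose i * n.choose (k - i) : ℕ) : ℝ) * q ^ (k.choose 2 - i.choose 2)) := by
  set 𝒜 := powersetCard k (univ : Finset (Fin n)) with h𝒜
  have hAk : #A = k := (mem_powersetCard.1 hA).2
  rw [← sum_filter, ← mul_sum]
  refine mul_le_mul_of_nonneg_left ?_ (pow_nonneg hq _)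
  rw [← sum_filter_add_sum_filter_not (𝒜.filter fun B => A ≠ B) (fun B => #(A ∩ B) ≤ 1)]
  refine add_le_add ?_ ?_
  · -- edge-disjoint second cliques: each term is `q^{C(k,2)}`, at most `C(n,k)` of them
    calc ∑ B ∈ (𝒜.filter fun B => A ≠ B).filter (fun B => #(A ∩ B) ≤ 1), q ^ (k.choose 2 - (#(A ∩ B)).choose 2)
        = ∑ B ∈ (𝒜.filter fun B => A ≠ B).filter (fun B => #(A ∩ B) ≤ 1), q ^ k.choose 2 := by
          refine sum_congr rfl fun B hB => ?_
          have hB1 : #(A ∩ B) ≤ 1 := (mem_filter.1 hB).2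
          rw [Nat.choose_eq_zero_of_lt (by omega : #(A ∩ B) < 2), Nat.sub_zero]
      _ ≤ (#𝒜 : ℝ) * q ^ k.choose 2 := by
          rw [sum_const, nsmul_eq_mul]
          gcongr
          exact (filter_subset _ _).trans (filter_subset _ _)
      _ = (n.choose k : ℝ) * q ^ k.choose 2 := by rw [h𝒜, card_powersetCard, card_univ, Fintype.card_fin]
  · -- overlapping second cliques: `2 ≤ |A ∩ B| ≤ k - 1`, grouped by `i = |A ∩ B|`
    have hmaps : ∀ B ∈ 𝒜.filter (fun B => #(A ∩ B) ∈ Ico 2 k), (fun B => #(A ∩ B)) B ∈ Ico 2 k :=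
      fun B hB => (mem_filter.1 hB).2
    calc ∑ B ∈ (𝒜.filter fun B => A ≠ B).filter (fun B => ¬ #(A ∩ B) ≤ 1), q ^ (k.choose 2 - (#(A ∩ B)).choose 2)
        ≤ ∑ B ∈ 𝒜.filter (fun B => #(A ∩ B) ∈ Ico 2 k), q ^ (k.choose 2 - (#(A ∩ B)).choose 2) := by
          refine sum_le_sum_of_subset_of_nonneg (fun B hB => ?_) (fun _ _ _ => pow_nonneg hq _)
          simp only [mem_filter, mem_Ico] at hB ⊢
          exact ⟨hB.1.1, by omega, card_inter_lt_of_ne hA hB.1.1 hB.1.2⟩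
      _ = ∑ i ∈ Ico 2 k, ∑ B ∈ (𝒜.filter (fun B => #(A ∩ B) ∈ Ico 2 k)).filter (fun B => #(A ∩ B) = i),
            q ^ (k.choose 2 - i.choose 2) := (sum_fiberwise_of_maps_to' hmaps (fun i => q ^ (k.choose 2 - i.choose 2))).symm
      _ ≤ ∑ i ∈ Ico 2 k, ((k.choose i * n.choose (k - i) : ℕ) : ℝ) * q ^ (k.choose 2 - i.choose 2) := by
          refine sum_le_sum fun i _ => ?_
          rw [sum_const, nsmul_eq_mul, filter_filter]
          refine mul_le_mul_of_nonneg_right ?_ (pow_nonneg hq _)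
          exact_mod_cast (card_le_card (fun B hB => by simp only [mem_filter] at hB ⊢; exact ⟨hB.1, hB.2.2⟩)).trans
            (card_filter_card_inter_eq_le hAk i)

/-- **Second factorial moment on the slice**: for `j ≤ C(n,2)` and `q = j/C(n,2)`,
`2 · #{x ∈ slice_j : ω_k(x) ≥ 2} ≤ μ · (μ + Σ_{i=2}^{k-1} C(k,i) C(n,k-i) q^{C(k,2)-C(i,2)}) · #slice_j`
with `μ = C(n,k) q^{C(k,2)}`. [folklore] -/
private theorem two_mul_card_le_moment {n k j : ℕ} (hjN : j ≤ n.choose 2) (hN : 0 < n.choose 2) :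
    2 * (#((slice n j).filter fun x => 2 ≤ cliqueCount n k x) : ℝ) ≤
      (n.choose k : ℝ) * ((j : ℝ) / (n.choose 2 : ℕ)) ^ k.choose 2 *
        ((n.choose k : ℝ) * ((j : ℝ) / (n.choose 2 : ℕ)) ^ k.choose 2 +
          ∑ i ∈ Ico 2 k, ((k.choose i * n.choose (k - i) : ℕ) : ℝ) * ((j : ℝ) / (n.choose 2 : ℕ)) ^ (k.choose 2 - i.choose 2)) *
        #(slice n j) := by
  set 𝒜 := powersetCard k (univ : Finset (Fin n)) with h𝒜
  set q : ℝ := (j : ℝ) / (n.choose 2 : ℕ) with hq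
  have hq0 : 0 ≤ q := div_nonneg (Nat.cast_nonneg _) (Nat.cast_nonneg _)
  have h1 := two_mul_card_filter_two_le n k j
  have h3 : ∑ p ∈ (𝒜 ×ˢ 𝒜).filter (fun p => p.1 ≠ p.2), q ^ k.choose 2 * q ^ (k.choose 2 - (#(p.1 ∩ p.2)).choose 2) ≤
      (n.choose k : ℝ) * q ^ k.choose 2 * ((n.choose k : ℝ) * q ^ k.choose 2 +
        ∑ i ∈ Ico 2 k, ((k.choose i * n.choose (k - i) : ℕ) : ℝ) * q ^ (k.choose 2 - i.choose 2)) := by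
    rw [sum_filter, sum_product]
    calc ∑ A ∈ 𝒜, ∑ B ∈ 𝒜, (if (A, B).1 ≠ (A, B).2 then q ^ k.choose 2 * q ^ (k.choose 2 - (#((A, B).1 ∩ (A, B).2)).choose 2) else 0)
        ≤ ∑ A ∈ 𝒜, q ^ k.choose 2 * ((n.choose k : ℝ) * q ^ k.choose 2 +
            ∑ i ∈ Ico 2 k, ((k.choose i * n.choose (k - i) : ℕ) : ℝ) * q ^ (k.choose 2 - i.choose 2)) :=
          sum_le_sum fun A hA => sum_ite_pow_le hA hq0
      _ = _ := by rw [sum_const, nsmul_eq_mul, h𝒜, card_powersetCard, card_univ, Fintype.card_fin]; ring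
  calc 2 * (#((slice n j).filter fun x => 2 ≤ cliqueCount n k x) : ℝ)
      = ((2 * #((slice n j).filter fun x => 2 ≤ cliqueCount n k x) : ℕ) : ℝ) := by push_cast; ring
    _ ≤ ∑ p ∈ (𝒜 ×ˢ 𝒜).filter (fun p => p.1 ≠ p.2), (#((slice n j).filter fun x =>
          (∀ e, cliqueVec p.1 e = true → x e = true) ∧ (∀ e, cliqueVec p.2 e = true → x e = true)) : ℝ) := by exact_mod_cast h1
    _ ≤ ∑ p ∈ (𝒜 ×ˢ 𝒜).filter (fun p => p.1 ≠ p.2), q ^ k.choose 2 * q ^ (k.choose 2 - (#(p.1 ∩ p.2)).choose 2) * #(slice n j) := by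
        refine sum_le_sum fun p hp => ?_
        simp only [mem_filter, mem_product] at hp
        exact card_slice_twoCliques_le hjN hN (mem_powersetCard.1 hp.1.1).2 (mem_powersetCard.1 hp.1.2).2
    _ ≤ _ := by rw [← sum_mul]; exact mul_le_mul_of_nonneg_right h3 (Nat.cast_nonneg _)

/-- **T5 `CoincidenceTail2`** (second factorial moment on the slice; Rossman, FOCS 2010, App. B, proof of Lemma 23 (a),
de-Poissonised): for `k ≥ 3` and `ε > 0`, eventually in `n`, on every central slice
`#{x ∈ slice_j : ω_k(x) ≥ 2} ≤ ((1/k!)²/2 + ε) · #slice_j`. [folklore] -/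
theorem stub_coincidenceTail2 :
    ∀ k : ℕ, 3 ≤ k → ∀ ε : ℝ, 0 < ε → ∀ᶠ n : ℕ in atTop, ∀ j : ℕ, Central k n j →
      (#((slice n j).filter fun x => 2 ≤ cliqueCount n k x) : ℝ) ≤
        ((1 / (k.factorial : ℝ)) ^ 2 / 2 + ε) * #(slice n j) := by
  intro k hk ε hε
  obtain ⟨hk2, hk1r⟩ : 2 ≤ k ∧ (1 : ℝ) < k := ⟨by omega, by exact_mod_cast (show 1 < k by omega)⟩
  -- threshold density `p`, expectation scale `T = C(n,2) p`, window factor `t = 1 + T^{-1/4}`, overlap error `R`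
  obtain ⟨p, hp⟩ : ∃ p : ℕ → ℝ, ∀ n : ℕ, p n = (n : ℝ) ^ (-(2 : ℝ) / ((k : ℝ) - 1)) := ⟨_, fun _ => rfl⟩
  obtain ⟨T, hT⟩ : ∃ T : ℕ → ℝ, ∀ n : ℕ, T n = ((n.choose 2 : ℕ) : ℝ) * p n := ⟨_, fun _ => rfl⟩
  obtain ⟨t, ht⟩ : ∃ t : ℕ → ℝ, ∀ n : ℕ, t n = 1 + (T n) ^ (-(1 / 4 : ℝ)) := ⟨_, fun _ => rfl⟩
  obtain ⟨R, hR⟩ : ∃ R : ℕ → ℝ, ∀ n : ℕ, R n =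
      ∑ i ∈ Ico 2 k, ((k.choose i * n.choose (k - i) : ℕ) : ℝ) * (2 * p n) ^ (k.choose 2 - i.choose 2) := ⟨_, fun _ => rfl⟩
  have hp0 : ∀ n : ℕ, 0 ≤ p n := fun n => by rw [hp n]; exact Real.rpow_nonneg (Nat.cast_nonneg _) _
  have hplim : Tendsto p atTop (𝓝 0) := (tendsto_rpow_threshold hk2).congr fun n => (hp n).symm
  -- `T → ∞` (adapted from Theorems/OneSliceConstantBandTransferStepAux.lean, `ts_T_ge`/`ts_tendsto_T`)
  have hTlim : Tendsto T atTop atTop := by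
    have h1 : Tendsto (fun n : ℕ => ((n : ℝ) - 1) / 2) atTop atTop := by
      refine Tendsto.atTop_div_const (by norm_num) ?_
      simpa [sub_eq_add_neg] using tendsto_atTop_add_const_right atTop (-1 : ℝ) tendsto_natCast_atTop_atTop
    refine tendsto_atTop_mono' atTop ?_ h1
    filter_upwards [eventually_ge_atTop 1] with n hn
    obtain ⟨hn1, hk'⟩ : (1 : ℝ) ≤ n ∧ (3 : ℝ) ≤ k := ⟨by exact_mod_cast hn, by exact_mod_cast hk⟩
    have hn0 : (n : ℝ) ≠ 0 := by positivity
    have hθ : (n : ℝ) ^ (-(1 : ℝ)) ≤ p n := by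
      rw [hp n]
      apply Real.rpow_le_rpow_of_exponent_le hn1
      rw [neg_div, neg_le_neg_iff, div_le_one (by linarith)]
      linarith
    calc ((n : ℝ) - 1) / 2 = ((n.choose 2 : ℕ) : ℝ) * (n : ℝ) ^ (-(1 : ℝ)) := by
          rw [Nat.cast_choose_two, Real.rpow_neg_one]; field_simp
      _ ≤ T n := by rw [hT n]; exact mul_le_mul_of_nonneg_left hθ (Nat.cast_nonneg _)
  -- `t → 1`
  have htlim : Tendsto t atTop (𝓝 1) := by
    have h2 := (tendsto_const_nhds (x := (1 : ℝ))).add ((tendsto_rpow_neg_atTop (by norm_num : (0 : ℝ) < 1 / 4)).comp hTlim)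
    rw [add_zero] at h2
    exact h2.congr fun n => (ht n).symm
  -- `R → 0`: the term `i` is `O(n^{k-i} · n^{-(2/(k-1))(C(k,2)-C(i,2))}) = O(n^{-i(k-i)/(k-1)})`
  -- (adapted from `Rossman2010_plantedVsConditioned_holds`, RossmanMonotoneCliqueLemma23Proofs.lean)
  have hRlim : Tendsto R atTop (𝓝 0) := by
    have hterm : ∀ i ∈ Ico 2 k, Tendsto (fun n : ℕ =>
        ((k.choose i * n.choose (k - i) : ℕ) : ℝ) * (2 * p n) ^ (k.choose 2 - i.choose 2)) atTop (𝓝 0) := by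
      intro i hi
      rw [mem_Ico] at hi
      have hiK : i.choose 2 ≤ k.choose 2 := Nat.choose_le_choose 2 hi.2.le
      have hexp : ((k - i : ℕ) : ℝ) + -(2 : ℝ) / ((k : ℝ) - 1) * ((k.choose 2 - i.choose 2 : ℕ) : ℝ) =
          -((i : ℝ) * ((k : ℝ) - i) / ((k : ℝ) - 1)) := by
        have hk1' : (k : ℝ) - 1 ≠ 0 := by linarith
        rw [Nat.cast_sub hiK, Nat.cast_choose_two, Nat.cast_choose_two, Nat.cast_sub hi.2.le]
        field_simp
        ring
      have hi2 : (2 : ℝ) ≤ i := by exact_mod_cast hi.1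
      have hik : (i : ℝ) < k := by exact_mod_cast hi.2
      have hneg : 0 < (i : ℝ) * ((k : ℝ) - i) / ((k : ℝ) - 1) := div_pos (mul_pos (by linarith) (by linarith)) (by linarith)
      have hlim' := ((tendsto_rpow_neg_atTop hneg).comp tendsto_natCast_atTop_atTop).const_mul
        ((k.choose i : ℝ) * 2 ^ (k.choose 2 - i.choose 2))
      rw [mul_zero] at hlim'
      refine squeeze_zero' (Eventually.of_forall fun n =>
        mul_nonneg (Nat.cast_nonneg _) (pow_nonneg (mul_nonneg zero_le_two (hp0 n)) _)) ?_ hlim'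
      filter_upwards [eventually_ge_atTop 1] with n hn1
      have hn0 : (0 : ℝ) < n := by exact_mod_cast hn1
      have h1 : ((k.choose i * n.choose (k - i) : ℕ) : ℝ) ≤ (k.choose i : ℝ) * (n : ℝ) ^ ((k - i : ℕ) : ℝ) := by
        rw [Real.rpow_natCast]
        push_cast
        exact mul_le_mul_of_nonneg_left (by exact_mod_cast Nat.choose_le_pow n (k - i)) (Nat.cast_nonneg _)
      calc ((k.choose i * n.choose (k - i) : ℕ) : ℝ) * (2 * p n) ^ (k.choose 2 - i.choose 2)
          ≤ (k.choose i : ℝ) * (n : ℝ) ^ ((k - i : ℕ) : ℝ) *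
              (2 ^ (k.choose 2 - i.choose 2) * ((n : ℝ) ^ (-(2 : ℝ) / ((k : ℝ) - 1))) ^ (k.choose 2 - i.choose 2)) := by
            rw [mul_pow, hp n]
            exact mul_le_mul_of_nonneg_right h1 (by positivity)
        _ = (k.choose i : ℝ) * 2 ^ (k.choose 2 - i.choose 2) * (n : ℝ) ^ (-((i : ℝ) * ((k : ℝ) - i) / ((k : ℝ) - 1))) := by
            rw [← Real.rpow_mul_natCast hn0.le, ← hexp, Real.rpow_add hn0]
            ring
    have hsum := tendsto_finsetSum (Ico 2 k) hterm
    rw [sum_const_zero] at hsum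
    exact hsum.congr fun n => (hR n).symm
  -- the majorant `m (m + R)` with `m = t^{C(k,2)}/k!` tends to `(1/k!)²`
  have hmlim : Tendsto (fun n => t n ^ k.choose 2 / (k.factorial : ℝ)) atTop (𝓝 (1 / (k.factorial : ℝ))) := by
    simpa using (htlim.pow (k.choose 2)).div_const (k.factorial : ℝ)
  have hGlim : Tendsto (fun n => t n ^ k.choose 2 / (k.factorial : ℝ) * (t n ^ k.choose 2 / (k.factorial : ℝ) + R n)) atTop
      (𝓝 ((1 / (k.factorial : ℝ)) ^ 2)) := by
    have h := hmlim.mul (hmlim.add hRlim)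
    rwa [add_zero, ← pow_two] at h
  have eG : ∀ᶠ n : ℕ in atTop, t n ^ k.choose 2 / (k.factorial : ℝ) * (t n ^ k.choose 2 / (k.factorial : ℝ) + R n) <
      (1 / (k.factorial : ℝ)) ^ 2 + 2 * ε := (tendsto_order.1 hGlim).2 _ (by linarith)
  have et : ∀ᶠ n : ℕ in atTop, t n < 2 := (tendsto_order.1 htlim).2 _ (by norm_num)
  have ep : ∀ᶠ n : ℕ in atTop, p n < 1 / 2 := (tendsto_order.1 hplim).2 _ (by norm_num)
  filter_upwards [eG, et, ep, hTlim.eventually_ge_atTop 1, eventually_ge_atTop 2] with n hGn htn hpn hTn hn2 j hj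
  have hn1 : 1 ≤ n := by omega
  have hN : 0 < n.choose 2 := Nat.choose_pos hn2
  have hNr : (0 : ℝ) < (n.choose 2 : ℕ) := by exact_mod_cast hN
  have hT0 : 0 < T n := by linarith
  have ht0 : 0 ≤ (T n) ^ (-(1 / 4 : ℝ)) := Real.rpow_nonneg hT0.le _
  have ht1 : 1 ≤ t n := by rw [ht n]; linarith
  -- the window: `j ≤ ⌊T⌋₊ + ⌊T⌋₊^{3/4} ≤ T (1 + T^{-1/4})`
  have hjT : (j : ℝ) ≤ T n * t n := by
    have hthr : thr k n = ⌊T n⌋₊ := by rw [hT n, hp n]; rfl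
    have hj' : |(j : ℝ) - (⌊T n⌋₊ : ℝ)| ≤ (⌊T n⌋₊ : ℝ) ^ ((3 : ℝ) / 4) := by
      have h := hj
      unfold Central at h
      rwa [hthr] at h
    have hfl : (⌊T n⌋₊ : ℝ) ≤ T n := Nat.floor_le hT0.le
    have := Real.rpow_le_rpow (Nat.cast_nonneg _) hfl (by norm_num : (0 : ℝ) ≤ 3 / 4)
    have hup := (abs_sub_le_iff.1 hj').1
    have hmul : T n * t n = T n + (T n) ^ ((3 : ℝ) / 4) := by
      rw [ht n, mul_add, mul_one, show (3 : ℝ) / 4 = 1 + -(1 / 4) by norm_num, Real.rpow_add hT0, Real.rpow_one]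
    rw [hmul]
    linarith
  have hjN' : (j : ℝ) ≤ (n.choose 2 : ℕ) := by
    calc (j : ℝ) ≤ T n * t n := hjT
      _ ≤ ((n.choose 2 : ℕ) : ℝ) * (1 / 2) * 2 := by
          rw [hT n]
          exact mul_le_mul (mul_le_mul_of_nonneg_left hpn.le (Nat.cast_nonneg _)) htn.le (by linarith) (by positivity)
      _ = (n.choose 2 : ℕ) := by ring
  have hjN : j ≤ n.choose 2 := by exact_mod_cast hjN'
  set q : ℝ := (j : ℝ) / (n.choose 2 : ℕ) with hqdef
  have hq0 : 0 ≤ q := div_nonneg (Nat.cast_nonneg _) hNr.le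
  have hqp : q ≤ 2 * p n := by
    rw [hqdef, div_le_iff₀ hNr]
    calc (j : ℝ) ≤ T n * t n := hjT
      _ ≤ T n * 2 := mul_le_mul_of_nonneg_left htn.le hT0.le
      _ = 2 * p n * (n.choose 2 : ℕ) := by rw [hT n]; ring
  -- `μ = C(n,k) q^{C(k,2)} ≤ t^{C(k,2)}/k!` and `R(q) ≤ R n`
  have hμ : (n.choose k : ℝ) * q ^ k.choose 2 ≤ t n ^ k.choose 2 / (k.factorial : ℝ) :=
    choose_mul_ratio_pow_le' hk2 hn1 hN (by rw [← hp n, ← hT n]; exact hjT)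
  have hRq : ∑ i ∈ Ico 2 k, ((k.choose i * n.choose (k - i) : ℕ) : ℝ) * q ^ (k.choose 2 - i.choose 2) ≤ R n := by
    rw [hR n]
    exact sum_le_sum fun i _ => mul_le_mul_of_nonneg_left (pow_le_pow_left₀ hq0 hqp _) (Nat.cast_nonneg _)
  have hμ0 : 0 ≤ (n.choose k : ℝ) * q ^ k.choose 2 := by positivity
  have hR0 : 0 ≤ ∑ i ∈ Ico 2 k, ((k.choose i * n.choose (k - i) : ℕ) : ℝ) * q ^ (k.choose 2 - i.choose 2) :=
    sum_nonneg fun i _ => mul_nonneg (Nat.cast_nonneg _) (pow_nonneg hq0 _)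
  have hm0 : 0 ≤ t n ^ k.choose 2 / (k.factorial : ℝ) := div_nonneg (pow_nonneg (by linarith) _) (Nat.cast_nonneg _)
  have hprod : (n.choose k : ℝ) * q ^ k.choose 2 * ((n.choose k : ℝ) * q ^ k.choose 2 +
      ∑ i ∈ Ico 2 k, ((k.choose i * n.choose (k - i) : ℕ) : ℝ) * q ^ (k.choose 2 - i.choose 2)) ≤
        t n ^ k.choose 2 / (k.factorial : ℝ) * (t n ^ k.choose 2 / (k.factorial : ℝ) + R n) :=
    mul_le_mul hμ (add_le_add hμ hRq) (add_nonneg hμ0 hR0) hm0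
  have hfin : 2 * (#((slice n j).filter fun x => 2 ≤ cliqueCount n k x) : ℝ) ≤ ((1 / (k.factorial : ℝ)) ^ 2 + 2 * ε) * #(slice n j) :=
    (two_mul_card_le_moment (k := k) hjN hN).trans (mul_le_mul_of_nonneg_right (hprod.trans hGn.le) (Nat.cast_nonneg _))
  have hrw : ((1 / (k.factorial : ℝ)) ^ 2 / 2 + ε) * #(slice n j) = (((1 / (k.factorial : ℝ)) ^ 2 + 2 * ε) * #(slice n j)) / 2 := by
    ring
  rw [hrw, le_div_iff₀ (two_pos : (0 : ℝ) < 2)]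
  linarith

end

end Summit.PneNP.PneNP.Cruxes.SliceTarget.Ideator3Line
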